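import Summits.QuantumFields.YangMills.Theorems.BalabanUVNodesN15KingModelAnalyticDeterminantVolumeLawFull
import Summits.QuantumFields.YangMills.Theorems.BalabanUVNodesN15KingModelCovariantBlockSmallField
import HarnessLib

/-!
# BalabanUVNodes ∕ N15 — THE KING-MODEL RUNG (PART Ϯ-o): THE BLOCK TERM IS ℓ¹-LIPSCHITZ IN THE BACKGROUND, η-UNIFORMLY — `|Re tr(A₀(W)⁻¹·a(P(U) − P(V)))| ≤ (2a|n|∕m²)·Σ_b‖U(b) − V(b)‖`:
# each diagonal entry of `Q(U)GQ(U)^* − Q(V)GQ(V)^*` at block `y` moves by at most `(2∕m²)·F_y`, `F_y = Σ_{contour bonds of y}‖U(b)−V(b)‖` (the transports TELESCOPE along the contours,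
# the rows of `Q` have norm `L^{−(d+1)∕2}`, the `L^{d+1}` paths of a block each see only their own bonds), and every bond belongs to one block's contours — PART Ϯ-c's crude `a|n|#Z∕m²`
# becomes `2a|n|‖U−V‖_{ℓ¹}∕m²`: LOCAL and LIPSCHITZ at once, with no `L`-dependence
# (Track A, DAG node N15 = NE2; FAN-OUT v1.1 §N15 s3 «KING-MODEL RUNG … + what the curved case adds»; count-neutral)

HONEST FRAMING.  Count-neutral (cell `pub-ymgap`, seat `pub-ymgap-dag-n15-e` g54; `--supports stmt-QuantumFields-27247 --as helper` = K3ᴬ, KEY MAP v3).  King's one-level comparison model,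
Bałaban's covariant block mean `Q(U)` on a tree contour system `T` (PART Ϥ), unitary `U, V, W`, `a ≥ 0`, `c ≥ 0`, `m² > 0`, any fibre `𝕜ⁿ`.  Finite-matrix bookkeeping; NOT Bałaban's (3.42);
NOT a node discharge (N15 of record untouched); nothing continuum ∕ ℝ⁴ ∕ OS ∕ Clay.

CONTENT.  §1 ★ `norm_treeHol_sub_le_pathSum` (`‖U(Γ_{y,x_j}) − V(Γ_{y,x_j})‖ ≤ Σ_{bonds of Γ_{y,x_j}}‖U(b)−V(b)‖` — Ϥ-n's telescoping in PATH-SUM form, Ϥ-a `pathSum`), ★ `norm_treeHol_sub_le_blockSum`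
(`≤ F_y := Σ_{z ≠ root}‖U(bond_y z) − V(bond_y z)‖`, Ϥ-a `pathSum_le_sum`), ★ `sum_blockSum_le_sum_bonds` (`Σ_y F_y ≤ Σ_b‖U(b) − V(b)‖`, Ϥ-b `treeBond_injective`); §2 `sum_norm_sq_row_le_opNorm_sq`
(`Σ_k‖B_{ik}‖² ≤ ‖B‖²`), `norm_sq_conjTranspose_mulVec_single` (`‖Aᴴe_p‖² = Σ_x‖A_{px}‖²`), ★ `norm_sq_conjTranspose_covQ_sub_mulVec_single_le` (`‖(Q(U)−Q(V))ᴴe_{(y,i)}‖² ≤ L^{−(d+1)}F_y²`),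
`norm_sq_conjTranspose_covQ_mulVec_single` (`‖Q(U)ᴴe_p‖² = L^{−(d+1)}`); §3 ★★ **`abs_re_sandwich_diag_sub_le`** (`|Re(Q(U)GQ(U)^*)_{pp} − Re(Q(V)GQ(V)^*)_{pp}| ≤ (2∕m²)F_y`, `G = A₀(W)⁻¹`);
§4 ★★★ **`abs_re_trace_mul_blockProjU_sub_le_l1`** (`|Re tr(G(P(U) − P(V)))| ≤ (2|n|∕m²)·Σ_b‖U(b) − V(b)‖`).

PRIOR TREE ART (by name, not restated): Ϥ-a `pathSum`∕`pathSum_of_ne_root`∕`pathSum_le_sum`∕`pathSum_nonneg`, Ϥ-b `treeHol_of_ne_root`∕`treeHol_mem_unitaryGroup`∕`treeBond_injective`∕`covQ_apply_site`,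
Ϥ-n `norm_mul_sub_mul_le_of_unitary`, Ϥ-k `sum_norm_sq_conjTranspose_covQ_mulVec`∕`re_quadForm_kingQadjU_sandwich`, Ϯ-c `norm_toLp_fullOpU_inv_mulVec_le`∕`sandwich_diag_eq_quadForm`∕
`norm_toLp_single_one`∕`trace_mul_blockProjU_eq`, Ͱ `re_star_dotProduct_le_norm_mul_norm`, `King1986.Torus.blockEquiv`, Mathlib `Matrix.l2_opNorm_mulVec`∕`l2_opNorm_conjTranspose`.
Dedup (rg at filing): basename 0 files; `norm_treeHol_sub_le_pathSum|norm_treeHol_sub_le_blockSum|sum_blockSum_le_sum_bonds|norm_sq_conjTranspose_covQ_sub_mulVec_single_le|abs_re_sandwich_diag_sub_le|abs_re_trace_mul_blockProjU_sub_le_l1` 0 tree files.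
Locators: [King1986] (2.11)–(2.14) p.653, (4.5) p.670; [Balaban1985BackgroundPropagators] (3.19) p.393, (3.24)–(3.25) p.394; [Balaban1984PropagatorsI] (1.7) p.18 (tree contours).  0 `sorry`, 0 `def`.
-/

noncomputable section

open scoped BigOperators ComplexConjugate ComplexOrder Matrix.Norms.L2Operator
open Finset Matrix WithLp

namespace Summit.QuantumFields.YangMills.BalabanUVNodes.N15KingModelRung.Analytic

open Literature.MathematicalPhysics.QuantumFieldTheory.Balaban1983to89.B5Prop11Plancherel (Tor fine unitVec)
open Literature.MathematicalPhysics.QuantumFieldTheory.King1986.Torus (site site_injective blockEquiv blockEquiv_apply)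
open Summit.QuantumFields.YangMills.BalabanUVNodes.N15KingModelRung.Covariant (re_star_dotProduct_le_norm_mul_norm l2_opNorm_of_mem_unitaryGroup_le)
open Summit.QuantumFields.YangMills.BalabanUVNodes.N15KingModelRung.CovariantBlock

variable {d : ℕ} {L : ℕ} [NeZero L] (T : BlockTree d L) (M : Fin (d + 1) → ℕ) [hM : ∀ μ, NeZero (M μ)]
variable {𝕜 : Type*} [RCLike 𝕜] {n : Type*} [Fintype n] [DecidableEq n]

/-! ## §1 The transports telescope along the contours, in ℓ¹ -/

section Telescope

variable {U V : Tor (fine L M) × Fin (d + 1) → Matrix n n 𝕜} (hU : ∀ bd, U bd ∈ Matrix.unitaryGroup n 𝕜) (hV : ∀ bd, V bd ∈ Matrix.unitaryGroup n 𝕜)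
include hU hV

omit hM in
/-- ★ THE TRANSPORTS TELESCOPE, PATH-SUM FORM: `‖U(Γ_{y,x_j}) − V(Γ_{y,x_j})‖ ≤ Σ_{z on the contour from x_j to the corner}‖U(bond_y z) − V(bond_y z)‖`, `bond_y z = (site y (parent z), axis z)`.
[cite: Balaban1985BackgroundPropagators, (3.19) p.393; Balaban1984PropagatorsI, (1.7) p.18] -/
theorem norm_treeHol_sub_le_pathSum (b : Tor M) :
    ∀ j, ‖treeHol M T U b j - treeHol M T V b j‖ ≤ pathSum T.toRootedTree (fun z => ‖U (site L M b (T.parent z), T.axis z) - V (site L M b (T.parent z), T.axis z)‖) j := by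
  refine T.induction (P := fun j => ‖treeHol M T U b j - treeHol M T V b j‖
      ≤ pathSum T.toRootedTree (fun z => ‖U (site L M b (T.parent z), T.axis z) - V (site L M b (T.parent z), T.axis z)‖) j) ?_ fun j hj ih => ?_
  · rw [treeHol_root, treeHol_root, sub_self, norm_zero]
    exact pathSum_nonneg _ (fun _ => norm_nonneg _) _
  · rw [treeHol_of_ne_root T M U b hj, treeHol_of_ne_root T M V b hj, pathSum_of_ne_root _ _ hj]
    calc ‖treeHol M T U b (T.parent j) * U (site L M b (T.parent j), T.axis j) - treeHol M T V b (T.parent j) * V (site L M b (T.parent j), T.axis j)‖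
        ≤ ‖treeHol M T U b (T.parent j) - treeHol M T V b (T.parent j)‖ + ‖U (site L M b (T.parent j), T.axis j) - V (site L M b (T.parent j), T.axis j)‖ :=
          norm_mul_sub_mul_le_of_unitary (hU _) (treeHol_mem_unitaryGroup T M hV b _)
      _ ≤ _ := by linarith [ih]

omit hM in
/-- ★ … hence `≤ F_y := Σ_{z ≠ root}‖U(bond_y z) − V(bond_y z)‖` (a path is a sub-family of the block's contour bonds, Ϥ-a `pathSum_le_sum`).
[cite: Balaban1985BackgroundPropagators, (3.19) p.393; Balaban1984PropagatorsI, (1.7) p.18] -/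
theorem norm_treeHol_sub_le_blockSum (b : Tor M) (j : Fin (d + 1) → Fin L) :
    ‖treeHol M T U b j - treeHol M T V b j‖
      ≤ ∑ z ∈ univ.filter (fun z => z ≠ T.root), ‖U (site L M b (T.parent z), T.axis z) - V (site L M b (T.parent z), T.axis z)‖ :=
  (norm_treeHol_sub_le_pathSum T M hU hV b j).trans (pathSum_le_sum _ (fun _ => norm_nonneg _) j)

end Telescope

/-- ★ EVERY BOND BELONGS TO ONE BLOCK's CONTOURS: `Σ_y F_y ≤ Σ_b‖U(b) − V(b)‖` (`(y, z) ↦ bond_y z` is injective, Ϥ-b `treeBond_injective`). [cite: Balaban1984PropagatorsI, (1.7) p.18] -/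
theorem sum_blockSum_le_sum_bonds (U V : Tor (fine L M) × Fin (d + 1) → Matrix n n 𝕜) :
    ∑ b : Tor M, ∑ z ∈ univ.filter (fun z => z ≠ T.root), ‖U (site L M b (T.parent z), T.axis z) - V (site L M b (T.parent z), T.axis z)‖
      ≤ ∑ bd : Tor (fine L M) × Fin (d + 1), ‖U bd - V bd‖ := by
  classical
  rw [← Finset.sum_product (s := (Finset.univ : Finset (Tor M))) (t := univ.filter (fun z => z ≠ T.root))
    (f := fun p => ‖U (site L M p.1 (T.parent p.2), T.axis p.2) - V (site L M p.1 (T.parent p.2), T.axis p.2)‖)]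
  set S := (Finset.univ : Finset (Tor M)) ×ˢ univ.filter (fun z => z ≠ T.root) with hS
  set φ : Tor M × (Fin (d + 1) → Fin L) → Tor (fine L M) × Fin (d + 1) := fun p => (site L M p.1 (T.parent p.2), T.axis p.2) with hφ
  have hinj : Set.InjOn φ ↑S := by
    intro p hp p' hp' h
    simp only [hS, Finset.coe_product, Set.mem_prod, Finset.mem_coe, Finset.mem_filter, Finset.mem_univ, true_and] at hp hp'
    obtain ⟨h1, h2⟩ := treeBond_injective T M hp hp' h
    exact Prod.ext h1 h2
  have hsum : ∑ p ∈ S, ‖U (site L M p.1 (T.parent p.2), T.axis p.2) - V (site L M p.1 (T.parent p.2), T.axis p.2)‖ = ∑ bd ∈ S.image φ, ‖U bd - V bd‖ := by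
    rw [Finset.sum_image hinj]
  rw [hsum]
  exact Finset.sum_le_sum_of_subset_of_nonneg (Finset.subset_univ _) fun _ _ _ => norm_nonneg _

/-! ## §2 Rows of `Q(U) − Q(V)` -/

section Rows

omit hM in
/-- `Σ_k‖B_{ik}‖² ≤ ‖B‖²` (a row is the image of a unit vector under `Bᴴ`). [folklore] -/
theorem sum_norm_sq_row_le_opNorm_sq (B : Matrix n n 𝕜) (i : n) : ∑ k, ‖B i k‖ ^ 2 ≤ ‖B‖ ^ 2 := by
  have h1 : ∑ k, ‖B i k‖ ^ 2 = ‖(toLp 2 (Bᴴ *ᵥ Pi.single i (1 : 𝕜)) : EuclideanSpace 𝕜 n)‖ ^ 2 := by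
    rw [EuclideanSpace.norm_sq_eq]
    refine Finset.sum_congr rfl fun k _ => ?_
    rw [PiLp.toLp_apply, Matrix.mulVec_single_one]
    change ‖B i k‖ ^ 2 = ‖Bᴴ k i‖ ^ 2
    rw [Matrix.conjTranspose_apply, norm_star]
  have h2 : ‖(toLp 2 (Pi.single i (1 : 𝕜)) : EuclideanSpace 𝕜 n)‖ = 1 := by
    rw [show (toLp 2 (Pi.single i (1 : 𝕜)) : EuclideanSpace 𝕜 n) = EuclideanSpace.single i (1 : 𝕜) from rfl, PiLp.norm_single, norm_one]
  have h3 : ‖(toLp 2 (Bᴴ *ᵥ Pi.single i (1 : 𝕜)) : EuclideanSpace 𝕜 n)‖ ≤ ‖B‖ := by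
    calc _ ≤ ‖Bᴴ‖ * ‖(toLp 2 (Pi.single i (1 : 𝕜)) : EuclideanSpace 𝕜 n)‖ := Matrix.l2_opNorm_mulVec Bᴴ (toLp 2 (Pi.single i (1 : 𝕜)) : EuclideanSpace 𝕜 n)
      _ = ‖B‖ := by rw [h2, mul_one, Matrix.l2_opNorm_conjTranspose]
  rw [h1]
  exact pow_le_pow_left₀ (norm_nonneg _) h3 2

/-- `‖Aᴴe_p‖² = Σ_x‖A_{px}‖²`. [folklore] -/
theorem norm_sq_conjTranspose_mulVec_single {α β : Type*} [Fintype α] [Fintype β] [DecidableEq α] (A : Matrix α β 𝕜) (p : α) :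
    ‖(toLp 2 (Aᴴ *ᵥ Pi.single p (1 : 𝕜)) : EuclideanSpace 𝕜 β)‖ ^ 2 = ∑ x, ‖A p x‖ ^ 2 := by
  rw [EuclideanSpace.norm_sq_eq]
  refine Finset.sum_congr rfl fun x _ => ?_
  rw [PiLp.toLp_apply, Matrix.mulVec_single_one]
  change ‖Aᴴ x p‖ ^ 2 = ‖A p x‖ ^ 2
  rw [Matrix.conjTranspose_apply, norm_star]

variable {U V : Tor (fine L M) × Fin (d + 1) → Matrix n n 𝕜} (hU : ∀ bd, U bd ∈ Matrix.unitaryGroup n 𝕜) (hV : ∀ bd, V bd ∈ Matrix.unitaryGroup n 𝕜)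
include hU hV

/-- ★ THE ROW `(y,i)` OF `Q(U) − Q(V)` IS SMALL: `‖(Q(U)−Q(V))ᴴe_{(y,i)}‖² ≤ L^{−(d+1)}·F_y²` — its entries are `L^{−(d+1)}(U(Γ_{y,x_j}) − V(Γ_{y,x_j}))_{ik}`, each transport difference is `≤ F_y` in operator norm
(§1), a row of an `n × n` matrix is below its operator norm, and there are `L^{d+1}` offsets `j`. [cite: Balaban1985BackgroundPropagators, (3.19) p.393; King1986, (2.11) p.653] -/
theorem norm_sq_conjTranspose_covQ_sub_mulVec_single_le (y : Tor M) (i : n) :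
    ‖(toLp 2 ((covQ T M U - covQ T M V)ᴴ *ᵥ Pi.single (y, i) (1 : 𝕜)) : EuclideanSpace 𝕜 (Tor (fine L M) × n))‖ ^ 2
      ≤ ((L : ℝ) ^ (d + 1))⁻¹ * (∑ z ∈ univ.filter (fun z => z ≠ T.root), ‖U (site L M y (T.parent z), T.axis z) - V (site L M y (T.parent z), T.axis z)‖) ^ 2 := by
  set F : ℝ := ∑ z ∈ univ.filter (fun z => z ≠ T.root), ‖U (site L M y (T.parent z), T.axis z) - V (site L M y (T.parent z), T.axis z)‖ with hF
  have hL : (0 : ℝ) < (L : ℝ) ^ (d + 1) := by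
    have : (0 : ℝ) < L := by exact_mod_cast Nat.pos_of_ne_zero (NeZero.ne L)
    positivity
  have hLk : ‖((L : 𝕜) ^ (d + 1))⁻¹‖ = ((L : ℝ) ^ (d + 1))⁻¹ := by rw [norm_inv, norm_pow, RCLike.norm_natCast]
  rw [norm_sq_conjTranspose_mulVec_single, Fintype.sum_prod_type, ← (blockEquiv L M).sum_comp]
  simp only [blockEquiv_apply, Fintype.sum_prod_type]
  -- only the block `y` contributes
  rw [Finset.sum_eq_single y]
  · have hentry : ∀ (j : Fin (d + 1) → Fin L) (k : n), ‖(covQ T M U - covQ T M V) (y, i) (site L M y j, k)‖ = ((L : ℝ) ^ (d + 1))⁻¹ * ‖(treeHol M T U y j - treeHol M T V y j) i k‖ := by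
      intro j k
      rw [Matrix.sub_apply, covQ_apply_site, covQ_apply_site, if_pos rfl, if_pos rfl, ← mul_sub, norm_mul, hLk, Matrix.sub_apply]
    simp_rw [hentry, mul_pow, ← Finset.mul_sum]
    have hcard : (Fintype.card (Fin (d + 1) → Fin L) : ℝ) = (L : ℝ) ^ (d + 1) := by
      rw [Fintype.card_fun, Fintype.card_fin, Fintype.card_fin]; push_cast; ring
    calc ((L : ℝ) ^ (d + 1))⁻¹ ^ 2 * ∑ j, ∑ k, ‖(treeHol M T U y j - treeHol M T V y j) i k‖ ^ 2
        ≤ ((L : ℝ) ^ (d + 1))⁻¹ ^ 2 * ∑ _j : Fin (d + 1) → Fin L, F ^ 2 := by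
          refine mul_le_mul_of_nonneg_left (Finset.sum_le_sum fun j _ => ?_) (by positivity)
          exact (sum_norm_sq_row_le_opNorm_sq (treeHol M T U y j - treeHol M T V y j) i).trans
            (pow_le_pow_left₀ (norm_nonneg _) (norm_treeHol_sub_le_blockSum T M hU hV y j) 2)
      _ = ((L : ℝ) ^ (d + 1))⁻¹ * F ^ 2 := by rw [Finset.sum_const, Finset.card_univ, nsmul_eq_mul, hcard]; field_simp
  · intro y' _ hy'
    refine Finset.sum_eq_zero fun j _ => Finset.sum_eq_zero fun k _ => ?_
    rw [Matrix.sub_apply, covQ_apply_site, covQ_apply_site, if_neg (Ne.symm hy'), if_neg (Ne.symm hy'), sub_zero, norm_zero]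
    simp
  · intro h; exact absurd (Finset.mem_univ y) h

omit hV in
/-- `‖Q(U)ᴴe_p‖² = L^{−(d+1)}` at a unitary background (Ϥ-k `L^{d+1}‖Q(U)ᴴf‖² = ‖f‖²`). [cite: Balaban1985BackgroundPropagators, (3.19) p.393] -/
theorem norm_sq_conjTranspose_covQ_mulVec_single (p : Tor M × n) :
    ‖(toLp 2 ((covQ T M U)ᴴ *ᵥ Pi.single p (1 : 𝕜)) : EuclideanSpace 𝕜 (Tor (fine L M) × n))‖ ^ 2 = ((L : ℝ) ^ (d + 1))⁻¹ := by
  have hL : (0 : ℝ) < (L : ℝ) ^ (d + 1) := by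
    have : (0 : ℝ) < L := by exact_mod_cast Nat.pos_of_ne_zero (NeZero.ne L)
    positivity
  have h := sum_norm_sq_conjTranspose_covQ_mulVec T M hU (Pi.single p (1 : 𝕜))
  rw [norm_toLp_single_one M p, one_pow] at h
  field_simp at h ⊢
  linarith

end Rows

/-! ## §3 One diagonal entry of the block term moves by at most `(2∕m²)·F_y` -/

section Diagonal

variable {a c m2 : ℝ} (ha : 0 ≤ a) (hc : 0 ≤ c) (hm : 0 < m2)
variable {U V W : Tor (fine L M) × Fin (d + 1) → Matrix n n 𝕜} (hU : ∀ bd, U bd ∈ Matrix.unitaryGroup n 𝕜) (hV : ∀ bd, V bd ∈ Matrix.unitaryGroup n 𝕜)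
  (hW : ∀ bd, W bd ∈ Matrix.unitaryGroup n 𝕜)
include ha hc hm hU hV hW

/-- ★★ **ONE DIAGONAL ENTRY OF THE BLOCK TERM IS LIPSCHITZ IN THE BACKGROUND ON ITS BLOCK**: for `G = A₀(W)⁻¹`, `p = (y,i)`,
`|Re(Q(U)GQ(U)^*)_{pp} − Re(Q(V)GQ(V)^*)_{pp}| ≤ (2∕m²)·F_y`, `F_y = Σ_{z ≠ root}‖U(bond_y z) − V(bond_y z)‖` — `⟨w_U,Gw_U⟩ − ⟨w_V,Gw_V⟩ = ⟨w_U−w_V,Gw_U⟩ + ⟨w_V,G(w_U−w_V)⟩` with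
`‖w_U‖ = ‖w_V‖ = L^{−(d+1)∕2}`, `‖w_U − w_V‖ ≤ L^{−(d+1)∕2}F_y`, `‖G‖ ≤ m⁻²`, times King's `L^{d+1}`. [cite: King1986, (2.13)–(2.14) p.653, (4.5) p.670; Balaban1985BackgroundPropagators, (3.19) p.393, (3.24)–(3.25) p.394] -/
theorem abs_re_sandwich_diag_sub_le (y : Tor M) (i : n) :
    |RCLike.re ((covQ T M U * (fullOpU T M a c m2 W)⁻¹ * kingQadjU T M U) (y, i) (y, i))
        - RCLike.re ((covQ T M V * (fullOpU T M a c m2 W)⁻¹ * kingQadjU T M V) (y, i) (y, i))|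
      ≤ 2 * m2⁻¹ * ∑ z ∈ univ.filter (fun z => z ≠ T.root), ‖U (site L M y (T.parent z), T.axis z) - V (site L M y (T.parent z), T.axis z)‖ := by
  set G := (fullOpU T M a c m2 W)⁻¹ with hG
  set F : ℝ := ∑ z ∈ univ.filter (fun z => z ≠ T.root), ‖U (site L M y (T.parent z), T.axis z) - V (site L M y (T.parent z), T.axis z)‖ with hF
  set e : Tor M × n → 𝕜 := Pi.single (y, i) 1 with he
  set wU := (covQ T M U)ᴴ *ᵥ e with hwU
  set wV := (covQ T M V)ᴴ *ᵥ e with hwV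
  have hL : (0 : ℝ) < (L : ℝ) ^ (d + 1) := by
    have : (0 : ℝ) < L := by exact_mod_cast Nat.pos_of_ne_zero (NeZero.ne L)
    positivity
  have hF0 : 0 ≤ F := Finset.sum_nonneg fun _ _ => norm_nonneg _
  rw [sandwich_diag_eq_quadForm M (covQ T M U * G * kingQadjU T M U) (y, i), sandwich_diag_eq_quadForm M (covQ T M V * G * kingQadjU T M V) (y, i),
    re_quadForm_kingQadjU_sandwich, re_quadForm_kingQadjU_sandwich, ← he, ← hwU, ← hwV, ← mul_sub]
  -- the norms of the rows
  set ρ : ℝ := ‖(toLp 2 wU : EuclideanSpace 𝕜 (Tor (fine L M) × n))‖ with hρ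
  have hρV : ‖(toLp 2 wV : EuclideanSpace 𝕜 (Tor (fine L M) × n))‖ = ρ := by
    have h1 := norm_sq_conjTranspose_covQ_mulVec_single T M hU (y, i)
    have h2 := norm_sq_conjTranspose_covQ_mulVec_single T M hV (y, i)
    rw [← he, ← hwU] at h1
    rw [← he, ← hwV] at h2
    exact (pow_left_inj₀ (norm_nonneg _) (norm_nonneg _) two_ne_zero).mp (h2.trans h1.symm)
  have hρ2 : ρ ^ 2 = ((L : ℝ) ^ (d + 1))⁻¹ := by
    have h1 := norm_sq_conjTranspose_covQ_mulVec_single T M hU (y, i)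
    rwa [← he, ← hwU] at h1
  have hρ0 : 0 ≤ ρ := norm_nonneg _
  -- the norm of the difference of the rows
  set σ : ℝ := ‖(toLp 2 (wU - wV) : EuclideanSpace 𝕜 (Tor (fine L M) × n))‖ with hσ
  have hσ0 : 0 ≤ σ := norm_nonneg _
  have hσ2 : σ ^ 2 ≤ ((L : ℝ) ^ (d + 1))⁻¹ * F ^ 2 := by
    have h := norm_sq_conjTranspose_covQ_sub_mulVec_single_le T M hU hV y i
    have e1 : (covQ T M U - covQ T M V)ᴴ *ᵥ e = wU - wV := by rw [Matrix.conjTranspose_sub, Matrix.sub_mulVec]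
    rwa [← he, e1] at h
  have hσρ : σ ≤ ρ * F := by
    have : σ ^ 2 ≤ (ρ * F) ^ 2 := by rw [mul_pow, hρ2]; exact hσ2
    exact (pow_le_pow_iff_left₀ hσ0 (mul_nonneg hρ0 hF0) two_ne_zero).mp this
  -- Cauchy–Schwarz twice with the mass floor
  have hGwU := norm_toLp_fullOpU_inv_mulVec_le T M ha hc hm hW wU
  have hGd := norm_toLp_fullOpU_inv_mulVec_le T M ha hc hm hW (wU - wV)
  have hsplit : RCLike.re (star wU ⬝ᵥ (G *ᵥ wU)) - RCLike.re (star wV ⬝ᵥ (G *ᵥ wV))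
      = RCLike.re (star (wU - wV) ⬝ᵥ (G *ᵥ wU)) + RCLike.re (star wV ⬝ᵥ (G *ᵥ (wU - wV))) := by
    rw [← map_add, ← map_sub]; congr 1
    rw [star_sub, sub_dotProduct, Matrix.mulVec_sub, dotProduct_sub]; ring
  have h1 := re_star_dotProduct_le_norm_mul_norm (fine L M) (wU - wV) (G *ᵥ wU)
  have h2 := re_star_dotProduct_le_norm_mul_norm (fine L M) wV (G *ᵥ (wU - wV))
  have h1' := re_star_dotProduct_le_norm_mul_norm (fine L M) (-(wU - wV)) (G *ᵥ wU)
  have h2' := re_star_dotProduct_le_norm_mul_norm (fine L M) (-wV) (G *ᵥ (wU - wV))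
  have en1 : ‖(toLp 2 (-(wU - wV)) : EuclideanSpace 𝕜 (Tor (fine L M) × n))‖ = σ := by rw [toLp_neg, norm_neg]
  have en2 : ‖(toLp 2 (-wV) : EuclideanSpace 𝕜 (Tor (fine L M) × n))‖ = ρ := by rw [toLp_neg, norm_neg, hρV]
  rw [star_neg, neg_dotProduct, map_neg] at h1' h2'
  rw [en1] at h1'
  rw [en2] at h2'
  rw [← hσ] at h1
  rw [hρV] at h2
  rw [← hρ] at hGwU
  have hb : |RCLike.re (star wU ⬝ᵥ (G *ᵥ wU)) - RCLike.re (star wV ⬝ᵥ (G *ᵥ wV))| ≤ 2 * m2⁻¹ * σ * ρ := by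
    rw [hsplit, abs_le]
    have hA : ‖(toLp 2 (G *ᵥ wU) : EuclideanSpace 𝕜 (Tor (fine L M) × n))‖ ≤ m2⁻¹ * ρ := hGwU
    have hB : ‖(toLp 2 (G *ᵥ (wU - wV)) : EuclideanSpace 𝕜 (Tor (fine L M) × n))‖ ≤ m2⁻¹ * σ := hGd
    have hσA : σ * ‖(toLp 2 (G *ᵥ wU) : EuclideanSpace 𝕜 (Tor (fine L M) × n))‖ ≤ σ * (m2⁻¹ * ρ) := mul_le_mul_of_nonneg_left hA hσ0
    have hρB : ρ * ‖(toLp 2 (G *ᵥ (wU - wV)) : EuclideanSpace 𝕜 (Tor (fine L M) × n))‖ ≤ ρ * (m2⁻¹ * σ) := mul_le_mul_of_nonneg_left hB hρ0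
    constructor <;> nlinarith
  calc |(L : ℝ) ^ (d + 1) * (RCLike.re (star wU ⬝ᵥ (G *ᵥ wU)) - RCLike.re (star wV ⬝ᵥ (G *ᵥ wV)))|
      = (L : ℝ) ^ (d + 1) * |RCLike.re (star wU ⬝ᵥ (G *ᵥ wU)) - RCLike.re (star wV ⬝ᵥ (G *ᵥ wV))| := by rw [abs_mul, abs_of_pos hL]
    _ ≤ (L : ℝ) ^ (d + 1) * (2 * m2⁻¹ * σ * ρ) := mul_le_mul_of_nonneg_left hb hL.le
    _ ≤ (L : ℝ) ^ (d + 1) * (2 * m2⁻¹ * (ρ * F) * ρ) := by gcongr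
    _ = 2 * m2⁻¹ * F * ((L : ℝ) ^ (d + 1) * ρ ^ 2) := by ring
    _ = 2 * m2⁻¹ * F := by rw [hρ2, mul_inv_cancel₀ hL.ne', mul_one]

end Diagonal

/-! ## §4 The block term is ℓ¹-Lipschitz in the background -/

section BlockTerm

variable {a c m2 : ℝ} (ha : 0 ≤ a) (hc : 0 ≤ c) (hm : 0 < m2)
variable {U V W : Tor (fine L M) × Fin (d + 1) → Matrix n n 𝕜} (hU : ∀ bd, U bd ∈ Matrix.unitaryGroup n 𝕜) (hV : ∀ bd, V bd ∈ Matrix.unitaryGroup n 𝕜)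
  (hW : ∀ bd, W bd ∈ Matrix.unitaryGroup n 𝕜)
include ha hc hm hU hV hW

/-- ★★★ **THE BLOCK TERM IS ℓ¹-LIPSCHITZ IN THE BACKGROUND, UNIFORMLY IN `L`**: for `G = A₀(W)⁻¹` (any unitary `W`),
`|Re tr(G·(P(U) − P(V)))| ≤ (2|n|∕m²)·Σ_b‖U(b) − V(b)‖` — PART Ϯ-c's `|n|·#Z∕m²` with the COUNT of changed bonds replaced by the ℓ¹ SIZE of the change; no `L`, no volume, no contour depth.
[cite: King1986, (2.11)–(2.14) p.653, (4.5) p.670; Balaban1985BackgroundPropagators, (3.19) p.393, (3.24)–(3.25) p.394; Balaban1984PropagatorsI, (1.7) p.18] -/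
theorem abs_re_trace_mul_blockProjU_sub_le_l1 :
    |RCLike.re ((fullOpU T M a c m2 W)⁻¹ * (blockProjU T M U - blockProjU T M V)).trace| ≤ 2 * (Fintype.card n : ℝ) * m2⁻¹ * ∑ bd, ‖U bd - V bd‖ := by
  set G := (fullOpU T M a c m2 W)⁻¹ with hG
  set F : Tor M → ℝ := fun y => ∑ z ∈ univ.filter (fun z => z ≠ T.root), ‖U (site L M y (T.parent z), T.axis z) - V (site L M y (T.parent z), T.axis z)‖ with hF
  have htr : RCLike.re (G * (blockProjU T M U - blockProjU T M V)).trace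
      = ∑ p : Tor M × n, (RCLike.re ((covQ T M U * G * kingQadjU T M U) p p) - RCLike.re ((covQ T M V * G * kingQadjU T M V) p p)) := by
    rw [Matrix.mul_sub, Matrix.trace_sub, trace_mul_blockProjU_eq, trace_mul_blockProjU_eq, map_sub, Matrix.trace, Matrix.trace, map_sum, map_sum, ← Finset.sum_sub_distrib]
    rfl
  rw [htr]
  calc |∑ p : Tor M × n, (RCLike.re ((covQ T M U * G * kingQadjU T M U) p p) - RCLike.re ((covQ T M V * G * kingQadjU T M V) p p))|
      ≤ ∑ p : Tor M × n, |RCLike.re ((covQ T M U * G * kingQadjU T M U) p p) - RCLike.re ((covQ T M V * G * kingQadjU T M V) p p)| := Finset.abs_sum_le_sum_abs _ _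
    _ ≤ ∑ p : Tor M × n, 2 * m2⁻¹ * F p.1 := Finset.sum_le_sum fun p _ => abs_re_sandwich_diag_sub_le T M ha hc hm hU hV hW p.1 p.2
    _ = 2 * m2⁻¹ * ((Fintype.card n : ℝ) * ∑ y, F y) := by
        rw [Fintype.sum_prod_type]
        simp only [Finset.sum_const, Finset.card_univ, nsmul_eq_mul]
        rw [Finset.mul_sum, Finset.mul_sum]
        exact Finset.sum_congr rfl fun y _ => by ring
    _ ≤ 2 * m2⁻¹ * ((Fintype.card n : ℝ) * ∑ bd, ‖U bd - V bd‖) :=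
        mul_le_mul_of_nonneg_left (mul_le_mul_of_nonneg_left (sum_blockSum_le_sum_bonds T M U V) (Nat.cast_nonneg _)) (by positivity)
    _ = 2 * (Fintype.card n : ℝ) * m2⁻¹ * ∑ bd, ‖U bd - V bd‖ := by ring

end BlockTerm

end Summit.QuantumFields.YangMills.BalabanUVNodes.N15KingModelRung.Analytic

end
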